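import Literature.MathematicalPhysics.QuantumLattice.SpinChainsLiebMattisSpinProofs
import Literature.MathematicalPhysics.QuantumLattice.SpinChainsLiebMattisProofs
import Literature.MathematicalPhysics.QuantumLattice.HeisenbergWindowCertificate
import Literature.MathematicalPhysics.QuantumLattice.GroundStateEnclosureCertificate
import HarnessLib

/-!
# Symmetry of the Heisenberg antiferromagnet's ground state (Marshall–Lieb–Mattis): uniqueness,
# the `Sᶻ = 0` sector, and character `+1` under lattice automorphisms and the spin flip

Topic `MathematicalPhysics/QuantumLattice` (family `hubbard`); sibling of
`SpinChainsLiebMattisSpinProofs.lean` (the discharged Lieb–Mattis theorem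
`marshall_lieb_mattis_spin_holds`) and of `GroundStateEnclosureCertificate.lean` (Kato–Temple
enclosures in a sector `K`). For the spin-`n/2` Heisenberg antiferromagnet
`H = J Σ_{edges} 𝐒_x·𝐒_y`, `J > 0`, on a finite connected graph bipartite in `A`, `Aᶜ` with
`|A| = |Aᶜ|` (every even torus), this file assembles the classical consequences of Marshall's sign
rule that symmetry-reduced exact diagonalisation uses to identify "the lowest state of the trivial
symmetry block" with THE ground state:

* `LiebMattis.hasUniqueGroundState_of_card_compl_eq` — the ground state is unique (`S₀ = 0`,
  degeneracy `2S₀ + 1 = 1`; Lieb–Mattis 1962 Thm 2).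
* `LiebMattis.groundSpace_le_spinZSector_zero` — it lies in the sector `Sᶻ_tot = 0`
  (weight `|Aᶜ| n`), where it is the Perron–Frobenius vector of the Marshall-conjugated block.
* `LiebMattis.permOp_mulVec_eq_self_of_map_eq` — it is INVARIANT (character `+1`) under the
  permutation unitary `permOp e` of every graph automorphism `e` mapping `A` onto `A`;
  `LiebMattis.permOp_mulVec_eq_self_of_map_eq_compl` — and of every automorphism mapping `A` onto
  `Aᶜ` provided `|A|·n` is even (e.g. the unit translations of an `L × L` torus, `L` even, spin ½:
  `|A| = L²/2` even iff `4 ∣ L²`); `LiebMattis.groundState_comp_flipCfg` — and under the global spin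
  flip `σ ↦ n - σ` provided `|A|·n` is even. (Marshall 1955: the amplitudes `(-1)^{Σ_{x∈A} σ_x} ψ(σ)`
  have one sign; a symmetry preserving the weight sector and the Marshall sign up to the parity of
  `|A| n` therefore acts by a POSITIVE scalar on a unit-norm-preserving image, i.e. trivially —
  `TempleKato.eq_of_groundSpace_of_apply_eq_pos_mul`.)
* `LiebMattis.groundSpace_le_of_symmetric` — packaged: a subspace `K` containing every `Sᶻ = 0`
  vector fixed by the listed automorphisms (and the flip) contains the ground space, so
  `minEnergyOn H K = groundEnergy H` and `(sectorGroundProj H K).projState = groundStateFunctional H`.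
* Transfer to certificates (generic, namespace `TempleKato`): if the ground space lies in a
  subspace `K` then `minEnergyOn A K = groundEnergy A` (`minEnergyOn_eq_groundEnergy_of_groundSpace_le`),
  `sectorGroundSpace A K = groundSpace A` and `(sectorGroundProj A K).projState = groundStateFunctional A`
  (`sectorGroundProj_eq_groundProj_of_groundSpace_le`), so a Kato–Temple / mixing certificate
  computed INSIDE the symmetric block `K` (`TempleKato.sector_enclosure`,
  `TempleKato.sector_expectation_enclosure`) bounds `groundEnergy` and the ground-state expectations.

Everything is PROVED from the tree's Lieb–Mattis files (`LiebMattis.sector_perronFrobenius`,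
`LiebMattis.lowestEnergyInSector_weight_eq_groundEnergy`, `marshall_lieb_mattis_spin_holds`), the
permutation unitaries `permOp` (`SpinChargeKinematics.lean`), `reindexOp_heisenbergHamiltonian`
and the flip lemmas `heisenberg_mulVec_comp_flipCfg`, `dotProduct_comp_flipCfg`; no definitions, no
named facts.

## References
* W. Marshall, Proc. Roy. Soc. A 232 (1955) 48–68 (sign rule). [Marshall1955]
* E. Lieb, D. Mattis, J. Math. Phys. 3 (1962) 749–751, Theorem 2 and its proof. [LiebMattis1962]
* H. Tasaki, *Physics and Mathematics of Quantum Many-Body Systems* (2020), §2.4 Thm 2.3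
  (Marshall–Lieb–Mattis theorem), §2.1 (symmetry of a unique ground state). [Tasaki2020]
-/

noncomputable section

open Matrix Finset
open scoped ComplexOrder BigOperators ComplexConjugate

namespace Literature.MathematicalPhysics.QuantumLattice

/-! ### Generic transfer: a subspace containing the ground space -/

namespace TempleKato

open EigenvalueContinuation

variable {ι : Type*} [Fintype ι] [DecidableEq ι]

/-- If every ground-state vector of a Hermitian `A` lies in `K`, the sector energy of `K` is the
ground energy. Tasaki (2020) §2.1. [folklore] -/
theorem minEnergyOn_eq_groundEnergy_of_groundSpace_le [Nonempty ι] {A : Matrix ι ι ℂ}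
    (hA : A.IsHermitian) {K : Submodule ℂ (ι → ℂ)} (hK : A.groundSpace ≤ K) :
    A.minEnergyOn K = A.groundEnergy := by
  obtain ⟨ψ, hψ, hψ0⟩ := (Submodule.ne_bot_iff _).1 (Matrix.groundSpace_ne_bot_holds hA)
  have hψK : ψ ∈ K := hK hψ
  have hAψ := (Matrix.mem_groundSpace_iff A ψ).1 hψ
  refine le_antisymm ?_ ?_
  · have h := minEnergyOn_mul_le_re_rayleigh hA K hψK
    rw [re_star_dotProduct_mulVec_of_eigen hAψ] at h
    exact le_of_mul_le_mul_right h (re_star_dotProduct_self_pos hψ0)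
  · obtain ⟨c, -, -, hc1⟩ := exists_normalize hψ0
    refine le_csInf ⟨_, (c : ℂ) • ψ, K.smul_mem _ hψK, hc1, rfl⟩ ?_
    rintro E ⟨φ, -, hφ1, rfl⟩
    exact Matrix.groundEnergy_le_rayleigh_holds hA φ hφ1

/-- If every ground-state vector lies in `K`, the sector ground multiplet of `K` is the ground space,
the sector ground projection is the ground projection, and the tracial sector ground state is the
tracial ground state. [folklore] -/
theorem sectorGroundProj_eq_groundProj_of_groundSpace_le [Nonempty ι] {A : Matrix ι ι ℂ}
    (hA : A.IsHermitian) {K : Submodule ℂ (ι → ℂ)} (hK : A.groundSpace ≤ K) :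
    A.sectorGroundSpace K = A.groundSpace ∧ A.sectorGroundProj K = A.groundProj ∧
      (A.sectorGroundProj K).projState = A.groundStateFunctional := by
  have hGS : A.sectorGroundSpace K = A.groundSpace := by
    rw [Matrix.sectorGroundSpace, minEnergyOn_eq_groundEnergy_of_groundSpace_le hA hK]
    change K ⊓ A.groundSpace = A.groundSpace
    exact inf_eq_right.2 hK
  have hP : A.sectorGroundProj K = A.groundProj := by
    rw [Matrix.sectorGroundProj, Matrix.groundProj_eq, hGS]
  exact ⟨hGS, hP, by rw [Matrix.groundStateFunctional_eq_projState, hP]⟩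

/-- A line argument: if the ground space is one-dimensional, `ψ`, `φ` are ground-state vectors of
equal norm and at some coordinate `φ i = r ψ i` with `r > 0` and `ψ i ≠ 0`, then `φ = ψ`.
[folklore] -/
theorem eq_of_groundSpace_of_apply_eq_pos_mul {A : Matrix ι ι ℂ}
    (hfin : Module.finrank ℂ A.groundSpace = 1) {ψ φ : ι → ℂ} (hψ : ψ ∈ A.groundSpace)
    (hφ : φ ∈ A.groundSpace) (hnorm : star φ ⬝ᵥ φ = star ψ ⬝ᵥ ψ) {i : ι} (hψi : ψ i ≠ 0)
    {r : ℝ} (hr : 0 < r) (hφi : φ i = (r : ℂ) * ψ i) : φ = ψ := by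
  have hψ0 : ψ ≠ 0 := fun h => hψi (by rw [h]; rfl)
  have hne : (⟨ψ, hψ⟩ : A.groundSpace) ≠ 0 := fun h => hψ0 (by simpa using congrArg Subtype.val h)
  obtain ⟨c, hc⟩ := (finrank_eq_one_iff_of_nonzero' _ hne).1 hfin ⟨φ, hφ⟩
  have hφc : φ = c • ψ := by simpa using (congrArg Subtype.val hc).symm
  have hcr : c = (r : ℂ) := by
    have h := congrFun hφc i
    rw [Pi.smul_apply, smul_eq_mul, hφi] at h
    exact (mul_right_cancel₀ hψi h).symm
  rw [hφc, hcr, star_smul, smul_dotProduct, dotProduct_smul, smul_smul, Complex.star_def,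
    Complex.conj_ofReal, smul_eq_mul] at hnorm
  have hN : star ψ ⬝ᵥ ψ ≠ 0 := fun h => hψ0 (dotProduct_star_self_eq_zero.1 h)
  have hrr : (r : ℂ) * r = 1 := mul_right_cancel₀ hN (by rw [hnorm, one_mul])
  have hr1 : r = 1 := by
    have : r * r = 1 := by exact_mod_cast hrr
    nlinarith
  rw [hφc, hcr, hr1, Complex.ofReal_one, one_smul]

/-- Positive reals along a common direction: if `d s a` and `d s b` are positive reals (`d, s ≠ 0`),
then `a ≠ 0` and `b = r a` for some real `r > 0`. [folklore] -/
theorem exists_pos_mul_of_pos {d s a b : ℂ} (hd : d ≠ 0) (hs : s ≠ 0)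
    (ha : 0 < (d * s * a).re ∧ (d * s * a).im = 0) (hb : 0 < (d * s * b).re ∧ (d * s * b).im = 0) :
    a ≠ 0 ∧ ∃ r : ℝ, 0 < r ∧ b = (r : ℂ) * a := by
  have ha0 : a ≠ 0 := by
    rintro rfl
    simp at ha
  obtain ⟨ha1, ha2⟩ := ha
  obtain ⟨hb1, hb2⟩ := hb
  set A' : ℝ := (d * s * a).re with hA'
  set B : ℝ := (d * s * b).re with hB
  have haR : d * s * a = (A' : ℂ) := Complex.ext (by simp [hA']) (by simp [ha2])
  have hbR : d * s * b = (B : ℂ) := Complex.ext (by simp [hB]) (by simp [hb2])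
  refine ⟨ha0, B / A', div_pos hb1 ha1, ?_⟩
  have hds : d * s ≠ 0 := mul_ne_zero hd hs
  refine mul_left_cancel₀ hds ?_
  calc d * s * b = (B : ℂ) := hbR
    _ = ((B / A' * A' : ℝ) : ℂ) := by rw [div_mul_cancel₀ _ ha1.ne']
    _ = ((B / A' : ℝ) : ℂ) * (d * s * a) := by rw [haR, ← Complex.ofReal_mul]
    _ = d * s * (((B / A' : ℝ) : ℂ) * a) := by ring

/-- `(-1)^a = (-1)^b` when `a + b` is even. [folklore] -/
theorem neg_one_pow_eq_of_even_add {a b : ℕ} (h : Even (a + b)) : ((-1 : ℂ)) ^ a = (-1) ^ b := by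
  have h1 : ((-1 : ℂ)) ^ a * (-1) ^ b = 1 := by rw [← pow_add]; exact h.neg_one_pow
  have h2 : ((-1 : ℂ)) ^ b * (-1) ^ b = 1 := by rw [← pow_add, ← two_mul, pow_mul]; simp
  calc ((-1 : ℂ)) ^ a = (-1) ^ a * ((-1) ^ b * (-1) ^ b) := by rw [h2, mul_one]
    _ = (-1) ^ b := by rw [← mul_assoc, h1, one_mul]

end TempleKato

/-! ### The Heisenberg antiferromagnet with `|A| = |Aᶜ|` -/

namespace LiebMattis

open TempleKato EigenvalueContinuation

variable {Λ : Type*} [Fintype Λ] [DecidableEq Λ] (n : ℕ) (G : SimpleGraph Λ) [DecidableRel G.Adj]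
  (A : Finset Λ) (J : ℝ)

/-- With `|Aᶜ| = |A|` the weight `W₀ = |Aᶜ| n` is the `Sᶻ_tot = 0` sector:
`|Λ| n / 2 - |Aᶜ| n = 0`. [folklore] -/
theorem magnetisation_of_weight_card_compl (hcard : Aᶜ.card = A.card) :
    ((Fintype.card Λ * n : ℕ) : ℝ) / 2 - ((Aᶜ.card * n : ℕ) : ℝ) = 0 := by
  have hΛ : Fintype.card Λ = A.card + Aᶜ.card := (Finset.card_add_card_compl A).symm
  rw [hΛ, hcard]
  push_cast
  ring

/-- **Uniqueness of the ground state** of the Heisenberg antiferromagnet (`J > 0`) on a connected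
graph bipartite in `A`, `Aᶜ` with `|A| = |Aᶜ|`: `S₀ = 0` and the degeneracy `2S₀ + 1` is `1`.
Lieb–Mattis (1962) Thm 2; Tasaki (2020) Thm 2.3. [cite: LiebMattis1962, Theorem 2] -/
theorem hasUniqueGroundState_of_card_compl_eq (hG : G.Connected)
    (hA : G.IsBipartiteWith (A : Set Λ) (↑A)ᶜ) (hJ : 0 < J) (hcard : Aᶜ.card = A.card) :
    (heisenbergHamiltonian n G J).HasUniqueGroundState := by
  obtain ⟨-, hdeg⟩ := marshall_lieb_mattis_spin_holds n G A J hG hA hJ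
  have hS : liebMattisSpin n A = 0 := by simp [liebMattisSpin, hcard]
  rw [hS, mul_zero, zero_add] at hdeg
  rw [Matrix.HasUniqueGroundState]
  exact_mod_cast hdeg

/-- The ground space is one-dimensional (restatement of uniqueness for `finrank`). [folklore] -/
theorem finrank_groundSpace_eq_one (hG : G.Connected) (hA : G.IsBipartiteWith (A : Set Λ) (↑A)ᶜ)
    (hJ : 0 < J) (hcard : Aᶜ.card = A.card) :
    Module.finrank ℂ (heisenbergHamiltonian n G J).groundSpace = 1 :=
  hasUniqueGroundState_of_card_compl_eq n G A J hG hA hJ hcard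

/-- **The ground state lies in the `Sᶻ_tot = 0` sector** (the weight-`|Aᶜ| n` sector), and there it
is the Perron–Frobenius vector: every ground-state vector `ψ` satisfies `ψ σ = 0` off weight
`|Aᶜ| n`, and (Marshall's sign rule) for some `d ≠ 0` all `d (-1)^{Σ_{x∈A} σ_x} ψ(σ)`, `σ` of
weight `|Aᶜ| n`, are positive reals. Lieb–Mattis (1962), proof of Thm 2; Marshall (1955);
Tasaki (2020) Thm 2.3. [cite: LiebMattis1962, Theorem 2] -/
theorem groundState_mem_sector_and_marshall (hG : G.Connected)
    (hA : G.IsBipartiteWith (A : Set Λ) (↑A)ᶜ) (hJ : 0 < J) (hcard : Aᶜ.card = A.card)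
    {ψ : TensorIndex Λ (n + 1) → ℂ} (hψ : ψ ∈ (heisenbergHamiltonian n G J).groundSpace)
    (hψ0 : ψ ≠ 0) :
    ψ ∈ spinZSector (Λ := Λ) n (((Fintype.card Λ * n : ℕ) : ℝ) / 2 - ((Aᶜ.card * n : ℕ) : ℝ)) ∧
      ∃ d : ℂ, d ≠ 0 ∧ ∀ σ : TensorIndex Λ (n + 1), (∑ z, (σ z : ℕ)) = Aᶜ.card * n →
        0 < (d * marshallSign A σ * ψ σ).re ∧ (d * marshallSign A σ * ψ σ).im = 0 := by
  set W₀ : ℕ := Aᶜ.card * n with hW₀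
  have hΛ : Fintype.card Λ = A.card + Aᶜ.card := (Finset.card_add_card_compl A).symm
  have hW₀le : W₀ ≤ Fintype.card Λ * n := by
    rw [hW₀, hΛ]; exact Nat.mul_le_mul_right n (by omega)
  have hW : ∃ σ : TensorIndex Λ (n + 1), (∑ z, (σ z : ℕ)) = W₀ := exists_weight_eq n W₀ hW₀le
  obtain ⟨⟨ψ₀, hψ₀K, hψ₀0, hHψ₀⟩, -, huniq, hpos⟩ := sector_perronFrobenius n G J A hG hA hJ W₀ hW
  have hE := lowestEnergyInSector_weight_eq_groundEnergy n G J A hG hA hJ hcard.le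
  rw [hE] at hHψ₀ huniq hpos
  -- `ψ₀` is a ground-state vector, hence spans the ground space; so `ψ = c ψ₀` lies in the sector
  have hψ₀GS : ψ₀ ∈ (heisenbergHamiltonian n G J).groundSpace :=
    (Matrix.mem_groundSpace_iff _ _).2 hHψ₀
  have hne : (⟨ψ₀, hψ₀GS⟩ : (heisenbergHamiltonian n G J).groundSpace) ≠ 0 :=
    fun h => hψ₀0 (by simpa using congrArg Subtype.val h)
  obtain ⟨c, hc⟩ := (finrank_eq_one_iff_of_nonzero' _ hne).1
    (finrank_groundSpace_eq_one n G A J hG hA hJ hcard) ⟨ψ, hψ⟩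
  have hψc : ψ = c • ψ₀ := by simpa using (congrArg Subtype.val hc).symm
  have hψK : ψ ∈ spinZSector (Λ := Λ) n (((Fintype.card Λ * n : ℕ) : ℝ) / 2 - ((W₀ : ℕ) : ℝ)) := by
    rw [hψc]; exact Submodule.smul_mem _ c hψ₀K
  refine ⟨hψK, ?_⟩
  exact hpos ψ hψK ((Matrix.mem_groundSpace_iff _ _).1 hψ) hψ0

/-- **The ground space lies in the `Sᶻ_tot = 0` sector.** [cite: LiebMattis1962, Theorem 2] -/
theorem groundSpace_le_spinZSector_zero (hG : G.Connected)
    (hA : G.IsBipartiteWith (A : Set Λ) (↑A)ᶜ) (hJ : 0 < J) (hcard : Aᶜ.card = A.card) :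
    (heisenbergHamiltonian n G J).groundSpace ≤ spinZSector (Λ := Λ) n 0 := by
  intro ψ hψ
  by_cases hψ0 : ψ = 0
  · rw [hψ0]; exact Submodule.zero_mem _
  have h := (groundState_mem_sector_and_marshall n G A J hG hA hJ hcard hψ hψ0).1
  rwa [magnetisation_of_weight_card_compl n A hcard] at h

/-! ### Marshall signs under relabellings and the flip -/

omit [Fintype Λ] [DecidableEq Λ] in
/-- The Marshall sign of a relabelled configuration: `(-1)^{Σ_{x∈A} σ(e x)} = (-1)^{Σ_{y∈e(A)} σ y}`.
[folklore] -/
theorem marshallSign_comp_equiv (e : Λ ≃ Λ) (σ : TensorIndex Λ (n + 1)) :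
    marshallSign A (fun x => σ (e x)) = (-1) ^ (∑ y ∈ A.map e.toEmbedding, (σ y : ℕ)) := by
  rw [marshallSign, Finset.sum_map]
  rfl

omit [Fintype Λ] [DecidableEq Λ] in
/-- If `e` maps `A` onto `A`, the Marshall sign is invariant. [folklore] -/
theorem marshallSign_comp_equiv_of_map_eq (e : Λ ≃ Λ) (hAe : ∀ x, e x ∈ A ↔ x ∈ A)
    (σ : TensorIndex Λ (n + 1)) : marshallSign A (fun x => σ (e x)) = marshallSign A σ := by
  have hmap : A.map e.toEmbedding = A := by
    ext y
    rw [Finset.mem_map]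
    constructor
    · rintro ⟨x, hx, rfl⟩
      exact (hAe x).2 hx
    · intro hy
      exact ⟨e.symm y, (hAe (e.symm y)).1 (by simpa using hy), by simp⟩
  rw [marshallSign_comp_equiv, hmap, marshallSign]

/-- If `e` maps `A` onto `Aᶜ` and the configuration has weight `W` with `W` even... precisely: for a
configuration of weight `Σ_z σ_z = W` with `W` even, `(-1)^{Σ_{y∈Aᶜ} σ_y} = (-1)^{Σ_{y∈A} σ_y}`, so
the Marshall sign is invariant under an `A ↔ Aᶜ` relabelling. [folklore] -/
theorem marshallSign_comp_equiv_of_map_eq_compl (e : Λ ≃ Λ) (hAe : ∀ x, e x ∈ A ↔ x ∉ A)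
    {σ : TensorIndex Λ (n + 1)} {W : ℕ} (hσ : (∑ z, (σ z : ℕ)) = W) (hW : Even W) :
    marshallSign A (fun x => σ (e x)) = marshallSign A σ := by
  have hmap : A.map e.toEmbedding = Aᶜ := by
    ext y
    rw [Finset.mem_map, Finset.mem_compl]
    constructor
    · rintro ⟨x, hx, rfl⟩
      exact fun h => ((hAe x).1 h) hx
    · intro hy
      refine ⟨e.symm y, ?_, by simp⟩
      by_contra hx
      have h := (hAe (e.symm y)).2 hx
      rw [Equiv.apply_symm_apply] at h
      exact hy h
  rw [marshallSign_comp_equiv, hmap, marshallSign]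
  apply neg_one_pow_eq_of_even_add
  rw [Finset.sum_compl_add_sum, hσ]
  exact hW

omit [Fintype Λ] [DecidableEq Λ] in
/-- The Marshall sign of the flipped configuration `σ ↦ n - σ`: equal to that of `σ` when `|A| n`
is even (`Σ_{x∈A} (n - σ_x) + Σ_{x∈A} σ_x = |A| n`). [folklore] -/
theorem marshallSign_flipCfg (hpar : Even (A.card * n)) (σ : TensorIndex Λ (n + 1)) :
    marshallSign A (flipCfg σ) = marshallSign A σ := by
  rw [marshallSign, marshallSign]
  apply neg_one_pow_eq_of_even_add
  have h : ∑ x ∈ A, ((flipCfg σ x : Fin (n + 1)) : ℕ) + ∑ x ∈ A, (σ x : ℕ) = A.card * n := by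
    rw [← Finset.sum_add_distrib]
    have : ∀ x ∈ A, ((flipCfg σ x : Fin (n + 1)) : ℕ) + (σ x : ℕ) = n := by
      intro x _
      simp only [flipCfg, Fin.val_rev]
      have := (σ x).isLt
      omega
    rw [Finset.sum_congr rfl this, Finset.sum_const, smul_eq_mul]
  rw [h]
  exact hpar

/-! ### Invariance of the ground state -/

/-- **The ground state is invariant under a sublattice-preserving automorphism.** For a graph
automorphism `e` (`G.Adj (e x) (e y) ↔ G.Adj x y`) mapping `A` onto `A`, every ground-state vector
satisfies `permOp e ψ = ψ` (the unique ground state carries the trivial character: `permOp e ψ` is a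
ground state of the same norm whose amplitude at a weight-`|Aᶜ|n` configuration `σ₀` is the
amplitude of `ψ` at `σ₀ ∘ e`, of the same Marshall sign, hence a POSITIVE multiple of `ψ(σ₀)`).
Marshall (1955); Lieb–Mattis (1962) Thm 2; Tasaki (2020) §2.4. [cite: LiebMattis1962, Theorem 2] -/
theorem permOp_mulVec_eq_self_of_map_eq (hG : G.Connected)
    (hA : G.IsBipartiteWith (A : Set Λ) (↑A)ᶜ) (hJ : 0 < J) (hcard : Aᶜ.card = A.card)
    (e : Λ ≃ Λ) (hadj : ∀ x y, G.Adj (e x) (e y) ↔ G.Adj x y) (hAe : ∀ x, e x ∈ A ↔ x ∈ A)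
    {ψ : TensorIndex Λ (n + 1) → ℂ} (hψ : ψ ∈ (heisenbergHamiltonian n G J).groundSpace) :
    (permOp e : Op Λ (n + 1)) *ᵥ ψ = ψ := by
  by_cases hψ0 : ψ = 0
  · rw [hψ0, mulVec_zero]
  obtain ⟨hψK, d, hd, hpos⟩ := groundState_mem_sector_and_marshall n G A J hG hA hJ hcard hψ hψ0
  set W₀ : ℕ := Aᶜ.card * n with hW₀
  -- the image is a ground state of the same norm
  have hcomm : (permOp e : Op Λ (n + 1)) * heisenbergHamiltonian n G J =
      heisenbergHamiltonian n G J * permOp e :=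
    (permOp_mul_eq_mul_permOp_iff e _).2 (reindexOp_heisenbergHamiltonian n G G e hadj J)
  have hφ : (permOp e : Op Λ (n + 1)) *ᵥ ψ ∈ (heisenbergHamiltonian n G J).groundSpace :=
    Matrix.mulVec_mem_groundSpace_of_commute hcomm hψ
  have hφeq : (permOp e : Op Λ (n + 1)) *ᵥ ψ = fun σ => ψ (fun x => σ (e x)) := permOp_mulVec e ψ
  have hnorm : star ((permOp e : Op Λ (n + 1)) *ᵥ ψ) ⬝ᵥ ((permOp e : Op Λ (n + 1)) *ᵥ ψ) =
      star ψ ⬝ᵥ ψ := by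
    rw [hφeq]
    simp only [dotProduct, Pi.star_apply]
    conv_rhs => rw [← Equiv.sum_comp (configPerm (q := n + 1) e)]
    simp only [configPerm_apply]
  -- a configuration of weight `W₀` and its relabelling
  have hΛ : Fintype.card Λ = A.card + Aᶜ.card := (Finset.card_add_card_compl A).symm
  obtain ⟨σ₀, hσ₀⟩ : ∃ σ : TensorIndex Λ (n + 1), (∑ z, (σ z : ℕ)) = W₀ :=
    exists_weight_eq n W₀ (by rw [hW₀, hΛ]; exact Nat.mul_le_mul_right n (by omega))
  have hσ₁ : (∑ z, ((fun x => σ₀ (e x)) z : ℕ)) = W₀ := by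
    rw [← hσ₀]; exact Equiv.sum_comp e (fun z => (σ₀ z : ℕ))
  have hs : marshallSign A (fun x => σ₀ (e x)) = marshallSign A σ₀ :=
    marshallSign_comp_equiv_of_map_eq n A e hAe σ₀
  have h0 := hpos σ₀ hσ₀
  have h1 := hpos (fun x => σ₀ (e x)) hσ₁
  rw [hs] at h1
  have hms : marshallSign A σ₀ ≠ 0 := by
    rcases marshallSign_eq_or A σ₀ with h | h <;> rw [h] <;> norm_num
  obtain ⟨hψσ₀, r, hr, hrr⟩ := exists_pos_mul_of_pos hd hms h0 h1
  refine eq_of_groundSpace_of_apply_eq_pos_mul (finrank_groundSpace_eq_one n G A J hG hA hJ hcard)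
    hψ hφ hnorm hψσ₀ hr ?_
  rw [hφeq]
  exact hrr

/-- **The ground state is invariant under a sublattice-exchanging automorphism when `|A| n` is
even.** For a graph automorphism `e` mapping `A` onto `Aᶜ` (e.g. a unit translation of an even
torus) and `|A|·n` even (spin ½ on an `L × L` torus: `L²/2` even), every ground-state vector
satisfies `permOp e ψ = ψ`. Marshall (1955); Lieb–Mattis (1962) Thm 2. [cite: LiebMattis1962, Theorem 2] -/
theorem permOp_mulVec_eq_self_of_map_eq_compl (hG : G.Connected)
    (hA : G.IsBipartiteWith (A : Set Λ) (↑A)ᶜ) (hJ : 0 < J) (hcard : Aᶜ.card = A.card)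
    (hpar : Even (A.card * n)) (e : Λ ≃ Λ) (hadj : ∀ x y, G.Adj (e x) (e y) ↔ G.Adj x y)
    (hAe : ∀ x, e x ∈ A ↔ x ∉ A)
    {ψ : TensorIndex Λ (n + 1) → ℂ} (hψ : ψ ∈ (heisenbergHamiltonian n G J).groundSpace) :
    (permOp e : Op Λ (n + 1)) *ᵥ ψ = ψ := by
  by_cases hψ0 : ψ = 0
  · rw [hψ0, mulVec_zero]
  obtain ⟨hψK, d, hd, hpos⟩ := groundState_mem_sector_and_marshall n G A J hG hA hJ hcard hψ hψ0
  set W₀ : ℕ := Aᶜ.card * n with hW₀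
  have hcomm : (permOp e : Op Λ (n + 1)) * heisenbergHamiltonian n G J =
      heisenbergHamiltonian n G J * permOp e :=
    (permOp_mul_eq_mul_permOp_iff e _).2 (reindexOp_heisenbergHamiltonian n G G e hadj J)
  have hφ : (permOp e : Op Λ (n + 1)) *ᵥ ψ ∈ (heisenbergHamiltonian n G J).groundSpace :=
    Matrix.mulVec_mem_groundSpace_of_commute hcomm hψ
  have hφeq : (permOp e : Op Λ (n + 1)) *ᵥ ψ = fun σ => ψ (fun x => σ (e x)) := permOp_mulVec e ψ
  have hnorm : star ((permOp e : Op Λ (n + 1)) *ᵥ ψ) ⬝ᵥ ((permOp e : Op Λ (n + 1)) *ᵥ ψ) =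
      star ψ ⬝ᵥ ψ := by
    rw [hφeq]
    simp only [dotProduct, Pi.star_apply]
    conv_rhs => rw [← Equiv.sum_comp (configPerm (q := n + 1) e)]
    simp only [configPerm_apply]
  have hΛ : Fintype.card Λ = A.card + Aᶜ.card := (Finset.card_add_card_compl A).symm
  obtain ⟨σ₀, hσ₀⟩ : ∃ σ : TensorIndex Λ (n + 1), (∑ z, (σ z : ℕ)) = W₀ :=
    exists_weight_eq n W₀ (by rw [hW₀, hΛ]; exact Nat.mul_le_mul_right n (by omega))
  have hσ₁ : (∑ z, ((fun x => σ₀ (e x)) z : ℕ)) = W₀ := by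
    rw [← hσ₀]; exact Equiv.sum_comp e (fun z => (σ₀ z : ℕ))
  have hW₀even : Even W₀ := by rw [hW₀, hcard]; exact hpar
  have hs : marshallSign A (fun x => σ₀ (e x)) = marshallSign A σ₀ :=
    marshallSign_comp_equiv_of_map_eq_compl n A e hAe hσ₀ hW₀even
  have h0 := hpos σ₀ hσ₀
  have h1 := hpos (fun x => σ₀ (e x)) hσ₁
  rw [hs] at h1
  have hms : marshallSign A σ₀ ≠ 0 := by
    rcases marshallSign_eq_or A σ₀ with h | h <;> rw [h] <;> norm_num
  obtain ⟨hψσ₀, r, hr, hrr⟩ := exists_pos_mul_of_pos hd hms h0 h1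
  refine eq_of_groundSpace_of_apply_eq_pos_mul (finrank_groundSpace_eq_one n G A J hG hA hJ hcard)
    hψ hφ hnorm hψσ₀ hr ?_
  rw [hφeq]
  exact hrr

/-- **The ground state is invariant under the global spin flip when `|A| n` is even**:
`ψ ∘ flip = ψ` with `flip σ = (x ↦ n - σ_x)` (`flipCfg`). Marshall (1955); Lieb–Mattis (1962)
Thm 2; Tasaki (2020) §2.1 eq. (2.1.26). [cite: LiebMattis1962, Theorem 2] -/
theorem groundState_comp_flipCfg (hG : G.Connected)
    (hA : G.IsBipartiteWith (A : Set Λ) (↑A)ᶜ) (hJ : 0 < J) (hcard : Aᶜ.card = A.card)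
    (hpar : Even (A.card * n))
    {ψ : TensorIndex Λ (n + 1) → ℂ} (hψ : ψ ∈ (heisenbergHamiltonian n G J).groundSpace) :
    ψ ∘ flipCfg = ψ := by
  by_cases hψ0 : ψ = 0
  · rw [hψ0]; rfl
  obtain ⟨hψK, d, hd, hpos⟩ := groundState_mem_sector_and_marshall n G A J hG hA hJ hcard hψ hψ0
  set W₀ : ℕ := Aᶜ.card * n with hW₀
  have hAψ := (Matrix.mem_groundSpace_iff _ _).1 hψ
  have hφ : ψ ∘ flipCfg ∈ (heisenbergHamiltonian n G J).groundSpace := by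
    rw [Matrix.mem_groundSpace_iff, heisenberg_mulVec_comp_flipCfg G J ψ, hAψ]
    rfl
  have hnorm : star (ψ ∘ flipCfg) ⬝ᵥ (ψ ∘ flipCfg) = star ψ ⬝ᵥ ψ := dotProduct_comp_flipCfg ψ ψ
  have hΛ : Fintype.card Λ = A.card + Aᶜ.card := (Finset.card_add_card_compl A).symm
  obtain ⟨σ₀, hσ₀⟩ : ∃ σ : TensorIndex Λ (n + 1), (∑ z, (σ z : ℕ)) = W₀ :=
    exists_weight_eq n W₀ (by rw [hW₀, hΛ]; exact Nat.mul_le_mul_right n (by omega))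
  have hσ₁ : (∑ z, ((flipCfg σ₀) z : ℕ)) = W₀ := by
    have h : ∑ z, ((flipCfg σ₀ z : Fin (n + 1)) : ℕ) + ∑ z, (σ₀ z : ℕ) = Fintype.card Λ * n := by
      rw [← Finset.sum_add_distrib]
      have : ∀ z ∈ (Finset.univ : Finset Λ), ((flipCfg σ₀ z : Fin (n + 1)) : ℕ) + (σ₀ z : ℕ) = n := by
        intro z _
        simp only [flipCfg, Fin.val_rev]
        have := (σ₀ z).isLt
        omega
      rw [Finset.sum_congr rfl this, Finset.sum_const, Finset.card_univ, smul_eq_mul]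
    rw [hσ₀, hΛ, Nat.add_mul] at h
    rw [hW₀] at h ⊢
    rw [hcard] at h ⊢
    omega
  have hs : marshallSign A (flipCfg σ₀) = marshallSign A σ₀ := marshallSign_flipCfg n A hpar σ₀
  have h0 := hpos σ₀ hσ₀
  have h1 := hpos (flipCfg σ₀) hσ₁
  rw [hs] at h1
  have hms : marshallSign A σ₀ ≠ 0 := by
    rcases marshallSign_eq_or A σ₀ with h | h <;> rw [h] <;> norm_num
  obtain ⟨hψσ₀, r, hr, hrr⟩ := exists_pos_mul_of_pos hd hms h0 h1
  exact eq_of_groundSpace_of_apply_eq_pos_mul (finrank_groundSpace_eq_one n G A J hG hA hJ hcard)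
    hψ hφ hnorm hψσ₀ hr hrr

/-! ### Consequence for symmetry-reduced certificates -/

/-- **Certificates may be computed in the symmetric block.** If a subspace `K` contains every vector
that (i) lies in the `Sᶻ_tot = 0` sector, (ii) is fixed by `permOp e` for the given
sublattice-preserving automorphisms `es₁` and sublattice-exchanging automorphisms `es₂`, and
(iii) is fixed by the spin flip (when `flip = true`), then — for `|A| = |Aᶜ|`, and `|A| n` even when
`es₂` is nonempty or `flip` is used — the ground space lies in `K`; hence
`minEnergyOn H K = groundEnergy H` and the tracial sector ground state of `K` is the tracial ground
state (`TempleKato.sectorGroundProj_eq_groundProj_of_groundSpace_le`), so that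
`TempleKato.sector_enclosure` / `sector_expectation_enclosure` with this `K` bound the ground
energy and the ground-state expectations of `H`. [cite: LiebMattis1962, Theorem 2] -/
theorem groundSpace_le_of_symmetric (hG : G.Connected)
    (hA : G.IsBipartiteWith (A : Set Λ) (↑A)ᶜ) (hJ : 0 < J) (hcard : Aᶜ.card = A.card)
    (es₁ es₂ : List (Λ ≃ Λ)) (flip : Bool)
    (hadj : ∀ e ∈ es₁ ++ es₂, ∀ x y, G.Adj (e x) (e y) ↔ G.Adj x y)
    (hA₁ : ∀ e ∈ es₁, ∀ x, e x ∈ A ↔ x ∈ A) (hA₂ : ∀ e ∈ es₂, ∀ x, e x ∈ A ↔ x ∉ A)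
    (hpar : (es₂ ≠ [] ∨ flip = true) → Even (A.card * n))
    (K : Submodule ℂ (TensorIndex Λ (n + 1) → ℂ))
    (hK : ∀ v : TensorIndex Λ (n + 1) → ℂ, v ∈ spinZSector (Λ := Λ) n 0 →
      (∀ e ∈ es₁ ++ es₂, (permOp e : Op Λ (n + 1)) *ᵥ v = v) →
      (flip = true → v ∘ flipCfg = v) → v ∈ K) :
    (heisenbergHamiltonian n G J).groundSpace ≤ K ∧
      (heisenbergHamiltonian n G J).minEnergyOn K = (heisenbergHamiltonian n G J).groundEnergy ∧
      ((heisenbergHamiltonian n G J).sectorGroundProj K).projState =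
        (heisenbergHamiltonian n G J).groundStateFunctional := by
  have hle : (heisenbergHamiltonian n G J).groundSpace ≤ K := by
    intro ψ hψ
    refine hK ψ (groundSpace_le_spinZSector_zero n G A J hG hA hJ hcard hψ) (fun e he => ?_)
      (fun hf => ?_)
    · rcases List.mem_append.1 he with he₁ | he₂
      · exact permOp_mulVec_eq_self_of_map_eq n G A J hG hA hJ hcard e (hadj e he) (hA₁ e he₁) hψ
      · have hne : es₂ ≠ [] := List.ne_nil_of_mem he₂
        exact permOp_mulVec_eq_self_of_map_eq_compl n G A J hG hA hJ hcard (hpar (Or.inl hne)) e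
          (hadj e he) (hA₂ e he₂) hψ
    · exact groundState_comp_flipCfg n G A J hG hA hJ hcard (hpar (Or.inr hf)) hψ
  haveI : Nonempty (TensorIndex Λ (n + 1)) := ⟨fun _ => 0⟩
  have hH := heisenbergHamiltonian_isHermitian n G J
  obtain ⟨-, -, hstate⟩ := sectorGroundProj_eq_groundProj_of_groundSpace_le hH hle
  exact ⟨hle, minEnergyOn_eq_groundEnergy_of_groundSpace_le hH hle, hstate⟩

end LiebMattis

end Literature.MathematicalPhysics.QuantumLattice

end
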